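import Summits.CriticalPhenomena.SAWScalingLimit.Theorems.SAWLeftRightFKGFKGToTraversalBoundSlitNecklaceOutline
import HarnessLib

/-!
# Wall-follower tour of a lattice site set: injectivity, periodicity, step geometry

Crux `SAWLeftRightFKG.FKGToTraversalBound` (stmt-CriticalPhenomena-1878), line `slit-necklace`, lead
prover-line-stmt-CriticalPhenomena-1878-c5-0; witness unit U1 (wall-follower tour), on top of the vocabulary
`…SlitNecklaceOutline` (`ODir`, `IsBEdge`, `bnext`, `btour`, `bsite`, `bcontact`).

* `eq_of_bnext_eq` — the wall-follower PREDECESSOR RULE (mirror image of `bnext`, stated as a theorem, no new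
  definition): a boundary edge is read off from its successor;
* `bnext_injective_of_isBEdge` (registered) — hence the successor rule is injective on boundary edges;
* `exists_bnext_eq` (rider) — and every boundary edge is the successor of a boundary edge;
* `btour_add`, `btour_cancel` — iterate bookkeeping: cancelling a common number of trailing steps;
* `finite_isBEdge`, `btour_periodic` (registered) — for finite `A` the tour of a boundary edge returns to it;
* `btour_add_of_eq`, `btour_mod_of_eq`, `btour_injOn_of_forall_ne`, `exists_minimal_period` (riders) —
  periodic continuation, and: before its first return the tour has no repeats;
* `bnext_step` (registered) — one step moves the outline site by `0`, by one lattice edge, or by two lattice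
  edges through a pixel of `A`, and moves the contact site by a king move (each coordinate changes by `≤ 1`).

All statements folklore ("wall follower" / boundary tracing of a polyomino); no literature fact; nothing
restates the crux.  The cancellation / periodicity pattern is adapted from
`Literature/Probability/Percolation/CellBoundary.lean` (`exists_period`, `bdOrbit_injOn`).
-/

noncomputable section

open Literature.Probability.LatticeModels

namespace Summit.CriticalPhenomena.SAWScalingLimit.Theorems.FKGToTraversalBound.SlitNecklace

namespace ODir

/-- Two counter-clockwise quarter turns reverse the unit vector. [folklore] -/
@[simp] theorem vec_ccw_ccw (d : ODir) : d.ccw.ccw.vec = -d.vec := by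
  fin_cases d <;> simp [ccw, vec]

/-- Two clockwise quarter turns reverse the unit vector. [folklore] -/
@[simp] theorem vec_cw_cw (d : ODir) : d.cw.cw.vec = -d.vec := by
  fin_cases d <;> simp [cw, vec]

/-- The coordinates of a unit vector are at most `1` in absolute value. [folklore] -/
theorem abs_vec_apply_le (d : ODir) (i : Fin 2) : |d.vec i| ≤ 1 := by
  fin_cases d <;> fin_cases i <;> simp [vec]

/-- The coordinates of the difference of two consecutive unit vectors are at most `1` in absolute value
(the two vectors are supported on different coordinates). [folklore] -/
theorem abs_vec_ccw_sub_vec_apply_le (d : ODir) (i : Fin 2) : |(d.ccw.vec - d.vec) i| ≤ 1 := by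
  fin_cases d <;> fin_cases i <;> simp [ccw, vec]

end ODir

/-! ### Evaluating the successor -/

/-- `bnext`, convex corner: turn left. [folklore] -/
theorem bnext_eq_of_notMem {A : Set (Site 2)} {x : Site 2} {d : ODir} (ha : x + d.ccw.vec ∉ A) :
    bnext A (x, d) = (x, d.ccw) := by
  classical
  simp [bnext, ha]

/-- `bnext`, flat boundary: straight on. [folklore] -/
theorem bnext_eq_of_mem_of_notMem {A : Set (Site 2)} {x : Site 2} {d : ODir} (ha : x + d.ccw.vec ∈ A)
    (ho : x + d.vec + d.ccw.vec ∉ A) : bnext A (x, d) = (x + d.ccw.vec, d) := by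
  classical
  simp [bnext, ha, ho]

/-- `bnext`, reflex corner: turn right. [folklore] -/
theorem bnext_eq_of_mem_of_mem {A : Set (Site 2)} {x : Site 2} {d : ODir} (ha : x + d.ccw.vec ∈ A)
    (ho : x + d.vec + d.ccw.vec ∈ A) : bnext A (x, d) = (x + d.vec + d.ccw.vec, d.cw) := by
  classical
  simp [bnext, ha, ho]

/-! ### The predecessor rule and injectivity -/

/-- **The predecessor rule** (mirror image of `bnext`; stated without introducing a definition).  If the boundary
edge `e` steps to `(x', d')`, then `e` is read off from the pixel BEHIND `b = x' + d'.cw` and the pixel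
BEHIND-RIGHT `o = x' + d' + d'.cw` of `(x', d')`:
* `b ∉ A`: the tour has just turned left around `x'`: `e = (x', d'.cw)`;
* `b ∈ A`, `o ∉ A`: the tour came straight: `e = (b, d')`;
* `b ∈ A`, `o ∈ A`: the tour has just turned right at a reflex corner: `e = (o, d'.ccw)`. [folklore] -/
theorem eq_of_bnext_eq (A : Set (Site 2)) {e : Site 2 × ODir} (he : IsBEdge A e) {x' : Site 2} {d' : ODir}
    (h : bnext A e = (x', d')) :
    (x' + d'.cw.vec ∉ A ∧ e = (x', d'.cw)) ∨
    (x' + d'.cw.vec ∈ A ∧ x' + d'.vec + d'.cw.vec ∉ A ∧ e = (x' + d'.cw.vec, d')) ∨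
    (x' + d'.cw.vec ∈ A ∧ x' + d'.vec + d'.cw.vec ∈ A ∧ e = (x' + d'.vec + d'.cw.vec, d'.ccw)) := by
  obtain ⟨x, d⟩ := e
  obtain ⟨hx, hxd⟩ := he
  simp only at hx hxd
  rcases bnext_cases A x d with ⟨-, h₁⟩ | ⟨-, -, h₁⟩ | ⟨ha, -, h₁⟩
  · rw [h₁] at h
    obtain ⟨hxx, hdd⟩ := Prod.mk.inj h
    rw [← hxx, ← hdd, ODir.cw_ccw]
    exact Or.inl ⟨hxd, rfl⟩
  · rw [h₁] at h
    obtain ⟨hxx, hdd⟩ := Prod.mk.inj h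
    rw [← hxx, ← hdd]
    have h1 : x + d.ccw.vec + d.cw.vec = x := by rw [ODir.vec_cw]; abel
    have h2 : x + d.ccw.vec + d.vec + d.cw.vec = x + d.vec := by rw [ODir.vec_cw]; abel
    rw [h1, h2]
    exact Or.inr (Or.inl ⟨hx, hxd, rfl⟩)
  · rw [h₁] at h
    obtain ⟨hxx, hdd⟩ := Prod.mk.inj h
    rw [← hxx, ← hdd]
    have h1 : x + d.vec + d.ccw.vec + d.cw.cw.vec = x + d.ccw.vec := by rw [ODir.vec_cw_cw]; abel
    have h2 : x + d.vec + d.ccw.vec + d.cw.vec + d.cw.cw.vec = x := by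
      rw [ODir.vec_cw, ODir.vec_cw_cw]; abel
    rw [h1, h2, ODir.ccw_cw]
    exact Or.inr (Or.inr ⟨ha, hx, rfl⟩)

/-- **Registered stub: the wall-follower successor is injective on boundary edges** (two boundary edges with
the same successor are read off from it by the same case of the predecessor rule). [folklore] -/
theorem bnext_injective_of_isBEdge : ∀ (A : Set (Site 2)) (e e' : Site 2 × ODir), IsBEdge A e → IsBEdge A e' → bnext A e = bnext A e' → e = e' := by
  intro A e e' he he' h
  rcases h' : bnext A e' with ⟨x', d'⟩
  rw [h'] at h
  rcases eq_of_bnext_eq A he h with ⟨hb, rfl⟩ | ⟨hb, ho, rfl⟩ | ⟨hb, ho, rfl⟩ <;>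
    rcases eq_of_bnext_eq A he' h' with ⟨hb', rfl⟩ | ⟨hb', ho', rfl⟩ | ⟨hb', ho', rfl⟩ <;>
    first | rfl | contradiction

/-- **Rider: every boundary edge is the successor of a boundary edge** (namely of the edge given by the
predecessor rule). [folklore] -/
theorem exists_bnext_eq : ∀ (A : Set (Site 2)) (e' : Site 2 × ODir), IsBEdge A e' →
    ∃ e : Site 2 × ODir, IsBEdge A e ∧ bnext A e = e' := by
  intro A e' he'
  obtain ⟨x, d⟩ := e'
  obtain ⟨hx, hxd⟩ := he'
  simp only at hx hxd
  by_cases hb : x + d.cw.vec ∈ A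
  · by_cases ho : x + d.vec + d.cw.vec ∈ A
    · refine ⟨(x + d.vec + d.cw.vec, d.ccw), ⟨ho, ?_⟩, ?_⟩
      · have : x + d.vec + d.cw.vec + d.ccw.vec = x + d.vec := by rw [ODir.vec_cw]; abel
        simpa [this] using hxd
      · have h1 : x + d.vec + d.cw.vec + d.ccw.ccw.vec = x + d.cw.vec := by rw [ODir.vec_ccw_ccw]; abel
        have h2 : x + d.vec + d.cw.vec + d.ccw.vec + d.ccw.ccw.vec = x := by
          rw [ODir.vec_cw, ODir.vec_ccw_ccw]; abel
        rw [bnext_eq_of_mem_of_mem (h1.symm ▸ hb) (h2.symm ▸ hx), h2, ODir.cw_ccw]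
    · refine ⟨(x + d.cw.vec, d), ⟨hb, by simpa [add_right_comm _ d.cw.vec] using ho⟩, ?_⟩
      have h1 : x + d.cw.vec + d.ccw.vec = x := by rw [ODir.vec_cw]; abel
      have h2 : x + d.cw.vec + d.vec + d.ccw.vec = x + d.vec := by rw [ODir.vec_cw]; abel
      rw [bnext_eq_of_mem_of_notMem (h1.symm ▸ hx) (h2.symm ▸ hxd), h1]
  · refine ⟨(x, d.cw), ⟨hx, hb⟩, ?_⟩
    have : x + d.cw.ccw.vec ∉ A := by rw [ODir.ccw_cw]; exact hxd
    rw [bnext_eq_of_notMem this, ODir.ccw_cw]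

/-! ### Periodicity -/

/-- `btour (m + n)`: first `m` steps, then `n` more. [folklore] -/
theorem btour_add (A : Set (Site 2)) (e₀ : Site 2 × ODir) (m n : ℕ) :
    btour A e₀ (m + n) = btour A (btour A e₀ m) n := by
  simp only [btour, ← Function.iterate_add_apply, add_comm]

/-- **Cancellation**: if the tour of a boundary edge agrees at steps `i + k` and `j + k`, it agrees at steps `i`
and `j` (injectivity of `bnext` on boundary edges, `k` times). [folklore] -/
theorem btour_cancel (A : Set (Site 2)) {e₀ : Site 2 × ODir} (h₀ : IsBEdge A e₀) {i j : ℕ} (k : ℕ)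
    (h : btour A e₀ (i + k) = btour A e₀ (j + k)) : btour A e₀ i = btour A e₀ j := by
  induction k with
  | zero => simpa using h
  | succ k ih =>
    apply ih
    rw [← add_assoc, ← add_assoc, btour_succ, btour_succ] at h
    exact bnext_injective_of_isBEdge A _ _ (btour_isBEdge A h₀ _) (btour_isBEdge A h₀ _) h

/-- If the tour of a boundary edge repeats, `btour i = btour j` with `i ≤ j`, then it has returned to its start
after `j - i` steps. [folklore] -/
theorem btour_sub_eq_of_eq (A : Set (Site 2)) {e₀ : Site 2 × ODir} (h₀ : IsBEdge A e₀) {i j : ℕ} (hij : i ≤ j)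
    (h : btour A e₀ i = btour A e₀ j) : btour A e₀ (j - i) = e₀ := by
  have key : btour A e₀ (0 + i) = btour A e₀ (j - i + i) := by
    rw [zero_add, Nat.sub_add_cancel hij]; exact h
  simpa using (btour_cancel A h₀ i key).symm

/-- The boundary edges of a finite site set form a finite set. [folklore] -/
theorem finite_isBEdge {A : Set (Site 2)} (hA : A.Finite) : {e : Site 2 × ODir | IsBEdge A e}.Finite :=
  (hA.prod Set.finite_univ).subset fun _ he => Set.mk_mem_prod he.1 (Set.mem_univ _)

/-- **Registered stub: the tour of a boundary edge of a finite site set is periodic.**  The tour takes values in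
the finite set of boundary edges, so it repeats; cancel the common prefix by injectivity. [folklore] -/
theorem btour_periodic : ∀ (A : Set (Site 2)), A.Finite → ∀ e₀ : Site 2 × ODir, IsBEdge A e₀ → ∃ N : ℕ, 0 < N ∧ btour A e₀ N = e₀ := by
  intro A hA e₀ h₀
  obtain ⟨i, j, hij, h⟩ :=
    (finite_isBEdge hA).exists_lt_map_eq_of_forall_mem (f := btour A e₀) fun n => btour_isBEdge A h₀ n
  exact ⟨j - i, Nat.sub_pos_of_lt hij, btour_sub_eq_of_eq A h₀ hij.le h⟩

/-- **Rider**: a period propagates: `btour (n + N) = btour n` once `btour N = e₀`. [folklore] -/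
theorem btour_add_of_eq (A : Set (Site 2)) {e₀ : Site 2 × ODir} {N : ℕ} (hN : btour A e₀ N = e₀) (n : ℕ) :
    btour A e₀ (n + N) = btour A e₀ n := by
  rw [add_comm, btour_add, hN]

/-- **Rider**: the tour reduced modulo a period. [folklore] -/
theorem btour_mod_of_eq (A : Set (Site 2)) {e₀ : Site 2 × ODir} {N : ℕ} (hN : btour A e₀ N = e₀) (n : ℕ) :
    btour A e₀ (n % N) = btour A e₀ n := by
  conv_rhs => rw [← Nat.mod_add_div n N]
  generalize n / N = q
  induction q with
  | zero => simp
  | succ q ih => rw [Nat.mul_succ, ← add_assoc, btour_add_of_eq A hN, ih]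

/-- **Rider: within one period the tour has no repeats.**  If the tour of the boundary edge `e₀` does not return
to `e₀` at any step `0 < m < N`, then its first `N` edges are pairwise distinct. [folklore] -/
theorem btour_injOn_of_forall_ne (A : Set (Site 2)) {e₀ : Site 2 × ODir} (h₀ : IsBEdge A e₀) {N : ℕ}
    (hN : ∀ m, 0 < m → m < N → btour A e₀ m ≠ e₀) : Set.InjOn (btour A e₀) (Set.Iio N) := by
  -- adapted from Literature/Probability/Percolation/CellBoundary.lean (`bdOrbit_injOn`)
  suffices H : ∀ i j : ℕ, j < N → btour A e₀ i = btour A e₀ j → ¬ i < j by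
    intro i hi j hj hij
    rcases lt_trichotomy i j with h | h | h
    · exact absurd h (H i j hj hij)
    · exact h
    · exact absurd h (H j i hi hij.symm)
  intro i j hj hij hlt
  exact hN (j - i) (Nat.sub_pos_of_lt hlt) (by omega) (btour_sub_eq_of_eq A h₀ hlt.le hij)

/-- **Rider**: with the minimal period `N` of `btour_periodic`, the first `N` tour edges are pairwise distinct and
exhaust the orbit. [folklore] -/
theorem exists_minimal_period (A : Set (Site 2)) (hA : A.Finite) {e₀ : Site 2 × ODir} (h₀ : IsBEdge A e₀) :
    ∃ N : ℕ, 0 < N ∧ btour A e₀ N = e₀ ∧ Set.InjOn (btour A e₀) (Set.Iio N) ∧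
      ∀ n, ∃ m < N, btour A e₀ n = btour A e₀ m := by
  classical
  obtain ⟨hpos, hper⟩ := Nat.find_spec (btour_periodic A hA e₀ h₀)
  refine ⟨Nat.find (btour_periodic A hA e₀ h₀), hpos, hper,
    btour_injOn_of_forall_ne A h₀ fun m hm hlt h => Nat.find_min (btour_periodic A hA e₀ h₀) hlt ⟨hm, h⟩,
    fun n => ⟨n % Nat.find (btour_periodic A hA e₀ h₀), Nat.mod_lt n hpos, (btour_mod_of_eq A hper n).symm⟩⟩

/-! ### Step geometry -/

/-- **Registered stub: the geometry of one step.**  The outline site stays (convex corner), moves by one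
lattice edge (straight on), or moves by two lattice edges through the pixel ahead, which lies in `A` (reflex
corner); the contact site moves by a king move: new contact minus old contact is `d.ccw - d`, `d.ccw`, or `0`
respectively. [folklore] -/
theorem bnext_step : ∀ (A : Set (Site 2)) (x : Site 2) (d : ODir), IsBEdge A (x, d) → ((bnext A (x, d)).1 = x ∨ (zdGraph 2).Adj x (bnext A (x, d)).1 ∨ (x + d.ccw.vec ∈ A ∧ (zdGraph 2).Adj x (x + d.ccw.vec) ∧ (zdGraph 2).Adj (x + d.ccw.vec) (bnext A (x, d)).1)) ∧ ∀ i : Fin 2, |(bcontact (bnext A (x, d)) - bcontact (x, d)) i| ≤ 1 := by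
  intro A x d _
  rcases bnext_cases A x d with ⟨-, h⟩ | ⟨-, -, h⟩ | ⟨ha, -, h⟩
  · rw [h]
    refine ⟨Or.inl rfl, fun i => ?_⟩
    have : bcontact (x, d.ccw) - bcontact (x, d) = d.ccw.vec - d.vec := by
      simp only [bcontact]; abel
    rw [this]
    exact ODir.abs_vec_ccw_sub_vec_apply_le d i
  · rw [h]
    refine ⟨Or.inr (Or.inl (ODir.adj_add_vec x d.ccw)), fun i => ?_⟩
    have : bcontact (x + d.ccw.vec, d) - bcontact (x, d) = d.ccw.vec := by
      simp only [bcontact]; abel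
    rw [this]
    exact ODir.abs_vec_apply_le d.ccw i
  · rw [h]
    refine ⟨Or.inr (Or.inr ⟨ha, ODir.adj_add_vec x d.ccw, ?_⟩), fun i => ?_⟩
    · rw [add_right_comm]
      exact ODir.adj_add_vec (x + d.ccw.vec) d
    · have : bcontact (x + d.vec + d.ccw.vec, d.cw) - bcontact (x, d) = 0 := by
        simp only [bcontact]; rw [ODir.vec_cw]; abel
      rw [this]
      simp

end Summit.CriticalPhenomena.SAWScalingLimit.Theorems.FKGToTraversalBound.SlitNecklace

end
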